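import Literature.Barriers.SmoothPoincare4.GluckTwistsDissolve
import Literature.Topology.FourManifolds.GluckDissolve
import Literature.Topology.FourManifolds.GluckTwistUniqueness
import Literature.Topology.FourManifolds.GluckTwistSimplyConnected
import Literature.Topology.FourManifolds.ConnectedSumAmphichiralUniqueness
import Literature.Topology.FourManifolds.OrientedConnectedSumUniqueness
import Literature.Topology.FourManifolds.ConnectedSumSphereIdentity
import Literature.Topology.FourManifolds.SphereIsometryDiffeotopy
import HarnessLib

/-!
# Gluck twists dissolve in `ℂℙ²` — every connected sum `Σ_K # ℂℙ²` is `ℂℙ²` (discharge of the fact)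

Second proofs sibling of `Literature/Barriers/SmoothPoincare4/GluckTwistsDissolve.lean` (barrier
catalogue D-0021), next to `GluckTwistsDissolveProofs.lean` (which proves the barrier
`GluckTwistCP2Barrier_holds` directly from ONE dissolving connected sum) and
`GluckTwistsDissolveRasmussenProofs.lean`. This file DISCHARGES the named fact itself, which
speaks about ALL connected sums:

* `Literature.Barriers.SmoothPoincare4.gluckTwist_connectedSum_complexProjectivePlane` — for every
  2-knot `K`, every Gluck twist `X` of `S⁴` along `K` (`IsGluckTwist (𝓡 4) X K`) and every smooth
  4-manifold `P` which is a connected sum of `X` with `ℂℙ²` in the tree's orientation-free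
  relational sense (`IsConnectedSum (𝓡 4) (𝓡 4) (𝓡 4) X ComplexProjectivePlane P`),
  `P ≅ ℂℙ²` (Kasprowski–Powell–Ray 2023, Lemma 3.1, smooth case after Gompf–Stipsicz 1999,
  Ex. 5.2.7(b); Akbulut–Yasui 2013, Cor. 1.3; both chiralities `X # ℂℙ² ≅ ℂℙ²`,
  `X # ℂℙ²bar ≅ ℂℙ²bar` as recorded in Manolescu–Marengon–Sarkar–Willis 2023, proof of Cor. 6.15)

as `gluckTwist_connectedSum_complexProjectivePlane_holds`, with no named fact as hypothesis and
the axiom closure `{propext, Classical.choice, Quot.sound}`. The barrier only needs one dissolving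
connected sum and is already a theorem (`GluckTwistCP2Barrier_holds`, sibling file); the fact is
the stronger printed statement "`X # ℂℙ² ≅ ℂℙ²` AND `X # ℂℙ²bar ≅ ℂℙ²bar`", i.e. both chiralities
of the orientation-free `IsConnectedSum`, and the second chirality is the work of this file.

## The proof

The geometric input is the tree's toric blow-up dissolution (`GluckDissolve.lean`,
`GluckDissolveAssembly.lean`, `GluckDissolveGlued.lean`): for a Gluck twist `X` presented as an
open gluing of `S⁴ ∖ K(S²)` and the tube `B = S² × ℝ²` along `gluckRel ν` by embeddings `(jA, jB)`,
the glued manifold `M = ν.Dissolve = (S⁴ ∖ ν(S² × D²)) ∪_τ Bl_p(S² × ℝ²)` is simultaneously a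
connected sum of `X` with `ℂℙ²` and a connected sum of `S⁴` with `ℂℙ²`. Four things are added.

1. **Explicit discs** (`dissolveSide_isOpenGluing_connectedSumRel`, §II.1): the neck presentation
   of the tree exhibits `M` as the open gluing along Kervaire–Milnor's relation for the SPECIFIC
   discs `c₁ = jB ∘ discB` (polar disc at the blown-up point `p = (N, 0)`) and
   `c₂ = (affineChart 2)⁻¹` — the tree's `isConnectedSum` with the existential opened up.
2. **`M ≅ ℂℙ²`**: `M` is a connected sum `S⁴ # ℂℙ²`, and `X # Sⁿ ≅ X` for arbitrary discs
   (`nonempty_diffeomorph_of_isConnectedSum_sphere'`, Palais' disc theorem in `Sⁿ`).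
3. **The disc-theorem dichotomy** (`isOpenGluing_connectedSumRel_or_reflect`, §II.2): an
   ARBITRARY connected sum `P` of `X` (connected, §I.8) with `ℂℙ²` (connected), glued along the
   relation for some discs `(i₁, i₂)`, is re-read — by the unoriented disc theorem of the tree
   (`exists_diffeomorph_apply_disc_eq_or_reflect_of_model`) in `X` and in `ℂℙ²` and a transport
   lemma (`isOpenGluing_connectedSumRel_transport`) — as an open gluing along the relation for
   `(c₁, c₂)` OR for `(c₁ ∘ r, c₂)`, `r` a fixed reflection of `ℝ⁴`. In the first case `P ≅ M` by
   uniqueness of open gluings (`IsOpenGluing.exists_diffeomorph_comp_eq`). The second case is the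
   OTHER CHIRALITY (`X # ℂℙ²bar` if the first is `X # ℂℙ²`): `ℂℙ²` admits no orientation-reversing
   diffeomorphism and `X` need not, so no soft argument relates it to the first.
4. **The conjugate presentation** (Part I, the new mathematics of this file): the same `X` is an
   open gluing of the same pieces along `gluckRel ν̄` for the CONJUGATE tube
   `ν̄ = ν ∘ (id × conj)` (fibre orientation reversed), by embeddings `(jA ∘ ψ, jB ∘ g)` where
   `g = E ∘ (id × conj)` with `E` a diffeomorphism of the tube equal to the identity on the unit
   tube (`isOpenGluing_gluckRel_conjTube_explicit`). Feeding THIS presentation to the tree's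
   construction for `ν̄` gives `M̄ = ν̄.Dissolve ≅ ℂℙ²`, an open gluing along the relation for
   `(jB ∘ g ∘ discB, c₂)`, and `jB ∘ g ∘ discB = c₁ ∘ r` on the unit ball for the reflection
   `r : y₃ ↦ -y₃` (`exists_reflection_discB_eq_conjB`); so in the second case `P ≅ M̄ ≅ ℂℙ²`.

   The maps of Part I. With `u = w/‖w‖`, `rot_u = rotateSphereTwo u` (about the `x₂`-axis),
   `σ_s = axisRot s` (about the `x₀`-axis, `σ_π rot_u σ_π = rot_ū`) and the smooth angle
   `s(w) = π (1 - χ(‖w‖²))` (`= 0` on `‖w‖ ≤ 1`, `= π` on `‖w‖ ≥ 2`):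
   `E (x, w) = (rot_ū σ_s rot_u σ_s x, w)` (`= id` on the unit tube, `= τ⁻²` far out; a
   diffeomorphism of `B`), `H (x, w) = (σ_s rot_u σ_s rot_u x, w) = τ E τ` off the zero section
   (`= τ²` near the core, `= id` far out), `ψ` = push-forward of `H` along `ν`, a diffeomorphism
   of the knot complement (it does not extend over `K`, and need not). The one-line heart is
   `H (c (τ b)) = τ (g b)` (`unwindH_conjB_gluckMap`), `c = id × conj`, `τ c = c τ⁻¹`. The
   existence of `E` is the null-homotopy of the loop `u ↦ rot_u²` in `SO(3)`; this is the
   classical fact that the Gluck twists by `τ` and `τ⁻¹` (equivalently, formed with either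
   orientation of the normal bundle) coincide (Gluck 1962, §8; Gompf–Stipsicz 1999, §6.2), in
   the explicit form that keeps control of the tube embedding near the core — which is exactly
   what the chirality bookkeeping of step 3 requires.

## What is NOT here

* No statement of `GluckTwistsDissolve.lean` or of any `Literature/Topology` file is modified;
  nothing is restated; no named fact is introduced (D-0026): every `def` below is an honest map or
  diffeomorphism, every claim a proved theorem.
* Orientations are never mentioned: the two chiralities are told apart by the explicit reflection
  `r` of the disc, not by orienting `X`, `ℂℙ²` or `P`.

## References

* H. Gluck, *The embedding of two-spheres in the four-sphere*, Trans. AMS 104 (1962), §8, §17.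
  [GluckTAMS1962]
* D. Kasprowski, M. Powell, A. Ray, *Gluck twists on concordant or homotopic spheres* (2023),
  Lemma 3.1. [KasprowskiPowellRay2023]
* S. Akbulut, K. Yasui, *Gluck twisting 4-manifolds with odd intersection form* (2013), Cor. 1.3.
  [AkbulutYasui2013]
* R. Gompf, A. Stipsicz, *4-Manifolds and Kirby Calculus* (1999), Ex. 5.2.7(b), §6.2.
  [GompfStipsicz1999]
* C. Manolescu, M. Marengon, S. Sarkar, M. Willis (2023), proof of Cor. 6.15.
  [ManolescuMarengonSarkarWillis2023]
* M. Kervaire, J. Milnor, *Groups of homotopy spheres I* (1963), §2. [KervaireMilnorAnnals1963]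
* R. Palais, *Extending diffeomorphisms* (1960), Thm. B. [Palais1960]
* A. Kosinski, *Differential Manifolds* (1993), VI §1. [Kosinski1993]
-/

noncomputable section

open scoped Manifold ContDiff Topology Real
open Set Function Metric Module
open Literature.Topology.FourManifolds

namespace Literature.Barriers.SmoothPoincare4

/-- Local notation: `𝔼 n` is the model Euclidean space `EuclideanSpace ℝ (Fin n)`. -/
local notation "𝔼 " n:arg => EuclideanSpace ℝ (Fin n)

/-- Local notation: `𝕊 n` is the unit sphere in `EuclideanSpace ℝ (Fin (n + 1))`. -/
local notation "𝕊 " n:arg => (Metric.sphere (0 : EuclideanSpace ℝ (Fin (n + 1))) 1)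

/-! ## Part I. The Gluck twist presented through the conjugate tubular neighbourhood

Throughout, `B = S² × ℝ²` is the tube, `τ = gluckMap` Gluck's map `(x, w) ↦ (rot_{w/‖w‖} x, w)`,
`rot_u = rotateSphereTwo u` the rotation about the `x₂`-axis, `σ_s = axisRot s` the rotation
about the `x₀`-axis, `χ = tubeCutoff`. -/

/-! ### I.1 The unwinding angle `s(w) = π (1 - χ(‖w‖²))` -/

/-- The **unwinding angle** `s(w) = π (1 - χ(‖w‖²))`: smooth, `= 0` for `‖w‖ ≤ 1`, `= π` for
`‖w‖ ≥ 2`, a function of `‖w‖` only. [folklore] -/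
def unwindAngle (w : 𝔼 2) : ℝ := π * (1 - tubeCutoff (‖w‖ ^ 2))

/-- `s = 0` on the unit disc. [folklore] -/
theorem unwindAngle_of_norm_le_one {w : 𝔼 2} (h : ‖w‖ ≤ 1) : unwindAngle w = 0 := by
  rw [unwindAngle, tubeCutoff_norm_sq_of_norm_le_one h, sub_self, mul_zero]

/-- `s = π` outside the disc of radius `2`. [folklore] -/
theorem unwindAngle_of_two_le {w : 𝔼 2} (h : 2 ≤ ‖w‖) : unwindAngle w = π := by
  rw [unwindAngle, tubeCutoff_norm_sq_of_two_le_norm h, sub_zero, mul_one]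

/-- `s` is invariant under conjugation of the plane. [folklore] -/
@[simp] theorem unwindAngle_conjPlane (w : 𝔼 2) : unwindAngle (conjPlane w) = unwindAngle w := by
  rw [unwindAngle, unwindAngle, norm_conjPlane]

/-- `s` is smooth. [folklore] -/
theorem contDiff_unwindAngle : ContDiff ℝ ∞ unwindAngle :=
  contDiff_const.mul (contDiff_const.sub contDiff_tubeCutoff_norm_sq)

/-! ### I.2 Two rotation words on `S²` -/

/-- The **twirl** `σ_s ∘ rot_u ∘ σ_s ∘ rot_u` of `S²`: for `s = 0` it is `rot_u²`, for `s = π` the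
identity (`σ' rot_u σ' = rot_ū`); as `s` runs from `0` to `π` this is a null-homotopy of the loop
`u ↦ rot_u²` in `SO(3)` (`π₁ SO(3) = ℤ/2`). [folklore] -/
def twirl (s : ℝ) (u : 𝕊 1) (x : 𝕊 2) : 𝕊 2 :=
  axisRot s (rotateSphereTwo u (axisRot s (rotateSphereTwo u x)))

/-- The inverse word of `twirl`. [folklore] -/
def untwirl (s : ℝ) (u : 𝕊 1) (x : 𝕊 2) : 𝕊 2 :=
  rotateSphereTwo (conjCircle u) (axisRot (-s) (rotateSphereTwo (conjCircle u) (axisRot (-s) x)))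

/-- `untwirl ∘ twirl = id`. [folklore] -/
@[simp] theorem untwirl_twirl (s : ℝ) (u : 𝕊 1) (x : 𝕊 2) : untwirl s u (twirl s u x) = x := by
  simp [twirl, untwirl]

/-- `twirl ∘ untwirl = id`. [folklore] -/
@[simp] theorem twirl_untwirl (s : ℝ) (u : 𝕊 1) (x : 𝕊 2) : twirl s u (untwirl s u x) = x := by
  simp [twirl, untwirl]

/-- At `s = 0` the twirl is the double rotation `rot_u²`. [folklore] -/
theorem twirl_zero (u : 𝕊 1) (x : 𝕊 2) :
    twirl 0 u x = rotateSphereTwo u (rotateSphereTwo u x) := by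
  simp [twirl]

/-- At `s = π` the twirl is the identity: `σ' rot_u σ' rot_u = rot_ū rot_u = id`. [folklore] -/
theorem twirl_pi (u : 𝕊 1) (x : 𝕊 2) : twirl π u x = x := by
  have h := rotateSphereTwo_conj_axisRot_pi u (axisRot π (rotateSphereTwo u x))
  rw [axisRot_pi_axisRot_pi, rotateSphereTwo_conj_rotateSphereTwo] at h
  exact h.symm

/-- The **spin** `rot_ū ∘ σ_s ∘ rot_u ∘ σ_s` of `S²` (identity for `s = 0`, `rot_ū²` for
`s = π`). [folklore] -/
def spin (s : ℝ) (u : 𝕊 1) (x : 𝕊 2) : 𝕊 2 :=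
  rotateSphereTwo (conjCircle u) (axisRot s (rotateSphereTwo u (axisRot s x)))

/-- The inverse word of `spin`. [folklore] -/
def unspin (s : ℝ) (u : 𝕊 1) (x : 𝕊 2) : 𝕊 2 :=
  axisRot (-s) (rotateSphereTwo (conjCircle u) (axisRot (-s) (rotateSphereTwo u x)))

/-- `unspin ∘ spin = id`. [folklore] -/
@[simp] theorem unspin_spin (s : ℝ) (u : 𝕊 1) (x : 𝕊 2) : unspin s u (spin s u x) = x := by
  simp [spin, unspin]

/-- `spin ∘ unspin = id`. [folklore] -/
@[simp] theorem spin_unspin (s : ℝ) (u : 𝕊 1) (x : 𝕊 2) : spin s u (unspin s u x) = x := by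
  simp [spin, unspin]

/-- At `s = 0` the spin is the identity. [folklore] -/
@[simp] theorem spin_zero (u : 𝕊 1) (x : 𝕊 2) : spin 0 u x = x := by
  simp [spin]

/-- At `s = 0` the unspin is the identity. [folklore] -/
@[simp] theorem unspin_zero (u : 𝕊 1) (x : 𝕊 2) : unspin 0 u x = x := by
  simp [unspin]

/-- **The intertwining identity** `twirl_s ū (rot_u x) = rot_ū (spin_s ū x)` (both sides equal
`σ_s rot_ū σ_s x`). [folklore] -/
theorem twirl_conjCircle_rotateSphereTwo (s : ℝ) (u : 𝕊 1) (x : 𝕊 2) :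
    twirl s (conjCircle u) (rotateSphereTwo u x) =
      rotateSphereTwo (conjCircle u) (spin s (conjCircle u) x) := by
  simp [twirl, spin]

/-! ### I.3 Smoothness of the rotation words in `(w, x)` off the zero section -/

section Smooth

/-- The unit vector field `b ↦ unitVector₀ b.2` is smooth off the zero section. [folklore] -/
theorem contMDiffOn_unitVector₀_snd :
    ContMDiffOn ((𝓡 2).prod 𝓘(ℝ, 𝔼 2)) (𝓡 1) ∞ (fun b : (𝕊 2) × 𝔼 2 => unitVector₀ b.2)
      {b | b.2 ≠ 0} :=
  contMDiffOn_unitVector₀.comp contMDiff_snd.contMDiffOn fun _ hb => hb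

/-- The conjugate unit vector field is smooth off the zero section. [folklore] -/
theorem contMDiffOn_conjCircle_unitVector₀_snd :
    ContMDiffOn ((𝓡 2).prod 𝓘(ℝ, 𝔼 2)) (𝓡 1) ∞
      (fun b : (𝕊 2) × 𝔼 2 => conjCircle (unitVector₀ b.2)) {b | b.2 ≠ 0} :=
  contMDiff_conjCircle.comp_contMDiffOn contMDiffOn_unitVector₀_snd

/-- The unwinding angle of the fibre coordinate is smooth. [folklore] -/
theorem contMDiff_unwindAngle_snd :
    ContMDiff ((𝓡 2).prod 𝓘(ℝ, 𝔼 2)) 𝓘(ℝ, ℝ) ∞ (fun b : (𝕊 2) × 𝔼 2 => unwindAngle b.2) :=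
  contDiff_unwindAngle.contMDiff.comp contMDiff_snd

variable {f : (𝕊 2) × 𝔼 2 → 𝕊 2} {θ : (𝕊 2) × 𝔼 2 → ℝ} {v : (𝕊 2) × 𝔼 2 → 𝕊 1}
  {S : Set ((𝕊 2) × 𝔼 2)}

/-- Post-composing a smooth family with the axis rotation through a smooth angle. [folklore] -/
theorem contMDiffOn_axisRot_comp (hθ : ContMDiffOn ((𝓡 2).prod 𝓘(ℝ, 𝔼 2)) 𝓘(ℝ, ℝ) ∞ θ S)
    (hf : ContMDiffOn ((𝓡 2).prod 𝓘(ℝ, 𝔼 2)) (𝓡 2) ∞ f S) :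
    ContMDiffOn ((𝓡 2).prod 𝓘(ℝ, 𝔼 2)) (𝓡 2) ∞ (fun b => axisRot (θ b) (f b)) S :=
  contMDiff_axisRot.comp_contMDiffOn (hθ.prodMk hf)

/-- Post-composing a smooth family with the rotation by a smooth unit vector. [folklore] -/
theorem contMDiffOn_rotateSphereTwo_comp
    (hv : ContMDiffOn ((𝓡 2).prod 𝓘(ℝ, 𝔼 2)) (𝓡 1) ∞ v S)
    (hf : ContMDiffOn ((𝓡 2).prod 𝓘(ℝ, 𝔼 2)) (𝓡 2) ∞ f S) :
    ContMDiffOn ((𝓡 2).prod 𝓘(ℝ, 𝔼 2)) (𝓡 2) ∞ (fun b => rotateSphereTwo (v b) (f b)) S :=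
  contMDiff_rotateSphereTwo.comp_contMDiffOn (hv.prodMk hf)

/-- The twirl field `b ↦ twirl (s b.2) (unitVector₀ b.2) b.1` is smooth off the zero section.
[folklore] -/
theorem contMDiffOn_twirl :
    ContMDiffOn ((𝓡 2).prod 𝓘(ℝ, 𝔼 2)) (𝓡 2) ∞
      (fun b : (𝕊 2) × 𝔼 2 => twirl (unwindAngle b.2) (unitVector₀ b.2) b.1) {b | b.2 ≠ 0} := by
  unfold twirl
  apply_rules [contMDiffOn_axisRot_comp, contMDiffOn_rotateSphereTwo_comp,
    contMDiff_unwindAngle_snd.contMDiffOn, contMDiffOn_unitVector₀_snd, contMDiff_fst.contMDiffOn]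

/-- The untwirl field is smooth off the zero section. [folklore] -/
theorem contMDiffOn_untwirl :
    ContMDiffOn ((𝓡 2).prod 𝓘(ℝ, 𝔼 2)) (𝓡 2) ∞
      (fun b : (𝕊 2) × 𝔼 2 => untwirl (unwindAngle b.2) (unitVector₀ b.2) b.1) {b | b.2 ≠ 0} := by
  unfold untwirl
  have hθ : ContMDiffOn ((𝓡 2).prod 𝓘(ℝ, 𝔼 2)) 𝓘(ℝ, ℝ) ∞
      (fun b : (𝕊 2) × 𝔼 2 => -unwindAngle b.2) {b | b.2 ≠ 0} :=
    contMDiff_unwindAngle_snd.neg.contMDiffOn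
  apply_rules [contMDiffOn_axisRot_comp, contMDiffOn_rotateSphereTwo_comp,
    contMDiffOn_conjCircle_unitVector₀_snd, contMDiff_fst.contMDiffOn]

/-- The spin field is smooth off the zero section. [folklore] -/
theorem contMDiffOn_spin :
    ContMDiffOn ((𝓡 2).prod 𝓘(ℝ, 𝔼 2)) (𝓡 2) ∞
      (fun b : (𝕊 2) × 𝔼 2 => spin (unwindAngle b.2) (unitVector₀ b.2) b.1) {b | b.2 ≠ 0} := by
  unfold spin
  apply_rules [contMDiffOn_axisRot_comp, contMDiffOn_rotateSphereTwo_comp,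
    contMDiff_unwindAngle_snd.contMDiffOn, contMDiffOn_unitVector₀_snd,
    contMDiffOn_conjCircle_unitVector₀_snd, contMDiff_fst.contMDiffOn]

/-- The unspin field is smooth off the zero section. [folklore] -/
theorem contMDiffOn_unspin :
    ContMDiffOn ((𝓡 2).prod 𝓘(ℝ, 𝔼 2)) (𝓡 2) ∞
      (fun b : (𝕊 2) × 𝔼 2 => unspin (unwindAngle b.2) (unitVector₀ b.2) b.1) {b | b.2 ≠ 0} := by
  unfold unspin
  have hθ : ContMDiffOn ((𝓡 2).prod 𝓘(ℝ, 𝔼 2)) 𝓘(ℝ, ℝ) ∞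
      (fun b : (𝕊 2) × 𝔼 2 => -unwindAngle b.2) {b | b.2 ≠ 0} :=
    contMDiff_unwindAngle_snd.neg.contMDiffOn
  apply_rules [contMDiffOn_axisRot_comp, contMDiffOn_rotateSphereTwo_comp,
    contMDiffOn_unitVector₀_snd, contMDiffOn_conjCircle_unitVector₀_snd,
    contMDiff_fst.contMDiffOn]

end Smooth

/-! ### I.4 The unwinding diffeomorphism `E` of the tube and the conjugate-and-unwind map -/

/-- The **unwinding map** `E (x, w) = (spin_{s(w)} u x, w) = (rot_ū σ_s rot_u σ_s x, w)`,
`u = w/‖w‖`, of the tube: a fibre-preserving rotation field, the identity on the unit tube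
`‖w‖ ≤ 1` (where `s = 0`) and `τ⁻² : (x, w) ↦ (rot_ū² x, w)` outside the tube of radius `2`
(where `s = π`). [folklore] -/
def unwindE (b : (𝕊 2) × 𝔼 2) : (𝕊 2) × 𝔼 2 :=
  (spin (unwindAngle b.2) (unitVector₀ b.2) b.1, b.2)

/-- The inverse of the unwinding map. [folklore] -/
def unwindEInv (b : (𝕊 2) × 𝔼 2) : (𝕊 2) × 𝔼 2 :=
  (unspin (unwindAngle b.2) (unitVector₀ b.2) b.1, b.2)

/-- `E` preserves the fibre coordinate. [folklore] -/
@[simp] theorem unwindE_snd (b : (𝕊 2) × 𝔼 2) : (unwindE b).2 = b.2 := rfl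

/-- `E⁻¹` preserves the fibre coordinate. [folklore] -/
@[simp] theorem unwindEInv_snd (b : (𝕊 2) × 𝔼 2) : (unwindEInv b).2 = b.2 := rfl

/-- `E⁻¹ ∘ E = id`. [folklore] -/
@[simp] theorem unwindEInv_unwindE (b : (𝕊 2) × 𝔼 2) : unwindEInv (unwindE b) = b := by
  obtain ⟨x, w⟩ := b
  simp [unwindE, unwindEInv]

/-- `E ∘ E⁻¹ = id`. [folklore] -/
@[simp] theorem unwindE_unwindEInv (b : (𝕊 2) × 𝔼 2) : unwindE (unwindEInv b) = b := by
  obtain ⟨x, w⟩ := b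
  simp [unwindE, unwindEInv]

/-- `E` is the identity on the unit tube. [folklore] -/
theorem unwindE_of_norm_le_one {b : (𝕊 2) × 𝔼 2} (h : ‖b.2‖ ≤ 1) : unwindE b = b := by
  obtain ⟨x, w⟩ := b
  simp only [unwindE, unwindAngle_of_norm_le_one h, spin_zero]

/-- `E⁻¹` is the identity on the unit tube. [folklore] -/
theorem unwindEInv_of_norm_le_one {b : (𝕊 2) × 𝔼 2} (h : ‖b.2‖ ≤ 1) : unwindEInv b = b := by
  obtain ⟨x, w⟩ := b
  simp only [unwindEInv, unwindAngle_of_norm_le_one h, unspin_zero]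

/-- A fibre-preserving map of the tube which is the identity on the unit tube and smooth off the
zero section is smooth. [folklore] -/
theorem contMDiff_of_eq_self_of_norm_le_one {F : (𝕊 2) × 𝔼 2 → (𝕊 2) × 𝔼 2}
    (h1 : ∀ b, ‖b.2‖ ≤ 1 → F b = b)
    (h2 : ContMDiffOn ((𝓡 2).prod 𝓘(ℝ, 𝔼 2)) ((𝓡 2).prod 𝓘(ℝ, 𝔼 2)) ∞ F {b | b.2 ≠ 0}) :
    ContMDiff ((𝓡 2).prod 𝓘(ℝ, 𝔼 2)) ((𝓡 2).prod 𝓘(ℝ, 𝔼 2)) ∞ F := by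
  intro b
  by_cases hb : ‖b.2‖ < 1
  · have hev : F =ᶠ[𝓝 b] id := by
      filter_upwards [(isOpen_lt (continuous_norm.comp continuous_snd) continuous_const).mem_nhds hb]
        with b' hb'
      exact h1 b' (le_of_lt hb')
    exact contMDiffAt_id.congr_of_eventuallyEq hev
  · have hb0 : b.2 ≠ 0 := by
      intro h
      rw [h, norm_zero] at hb
      exact hb one_pos
    exact h2.contMDiffAt ((isOpen_ne.preimage continuous_snd).mem_nhds hb0)

/-- `E` is smooth. [folklore] -/
theorem contMDiff_unwindE :
    ContMDiff ((𝓡 2).prod 𝓘(ℝ, 𝔼 2)) ((𝓡 2).prod 𝓘(ℝ, 𝔼 2)) ∞ unwindE :=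
  contMDiff_of_eq_self_of_norm_le_one (fun _ h => unwindE_of_norm_le_one h)
    (contMDiffOn_spin.prodMk contMDiff_snd.contMDiffOn)

/-- `E⁻¹` is smooth. [folklore] -/
theorem contMDiff_unwindEInv :
    ContMDiff ((𝓡 2).prod 𝓘(ℝ, 𝔼 2)) ((𝓡 2).prod 𝓘(ℝ, 𝔼 2)) ∞ unwindEInv :=
  contMDiff_of_eq_self_of_norm_le_one (fun _ h => unwindEInv_of_norm_le_one h)
    (contMDiffOn_unspin.prodMk contMDiff_snd.contMDiffOn)

/-- The unwinding map as a **diffeomorphism of the tube**. [folklore] -/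
def unwindEDiffeo :
    ((𝕊 2) × 𝔼 2) ≃ₘ⟮(𝓡 2).prod 𝓘(ℝ, 𝔼 2), (𝓡 2).prod 𝓘(ℝ, 𝔼 2)⟯ ((𝕊 2) × 𝔼 2) where
  toFun := unwindE
  invFun := unwindEInv
  left_inv := unwindEInv_unwindE
  right_inv := unwindE_unwindEInv
  contMDiff_toFun := contMDiff_unwindE
  contMDiff_invFun := contMDiff_unwindEInv

/-- The unwinding diffeomorphism as a function. [folklore] -/
@[simp] theorem coe_unwindEDiffeo : ⇑unwindEDiffeo = unwindE := rfl

/-- **Conjugation of the fibre** `c (x, w) = (x, w̄)` of the tube. [folklore] -/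
def conjB (b : (𝕊 2) × 𝔼 2) : (𝕊 2) × 𝔼 2 := (b.1, conjPlane b.2)

/-- `c` is an involution. [folklore] -/
@[simp] theorem conjB_conjB (b : (𝕊 2) × 𝔼 2) : conjB (conjB b) = b := by
  obtain ⟨x, w⟩ := b
  simp [conjB]

/-- The fibre coordinate of `c b`. [folklore] -/
@[simp] theorem conjB_snd (b : (𝕊 2) × 𝔼 2) : (conjB b).2 = conjPlane b.2 := rfl

/-- The sphere coordinate of `c b`. [folklore] -/
@[simp] theorem conjB_fst (b : (𝕊 2) × 𝔼 2) : (conjB b).1 = b.1 := rfl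

/-- `c` on the zero section. [folklore] -/
@[simp] theorem conjB_zero (x : 𝕊 2) : conjB (x, 0) = (x, 0) := by
  simp [conjB]

/-- Conjugation of the fibre as a diffeomorphism of the tube. [folklore] -/
def conjBDiffeo :
    ((𝕊 2) × 𝔼 2) ≃ₘ⟮(𝓡 2).prod 𝓘(ℝ, 𝔼 2), (𝓡 2).prod 𝓘(ℝ, 𝔼 2)⟯ ((𝕊 2) × 𝔼 2) :=
  (Diffeomorph.refl (𝓡 2) (𝕊 2) ∞).prodCongr conjPlaneDiffeo

/-- The conjugation diffeomorphism as a function. [folklore] -/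
@[simp] theorem coe_conjBDiffeo : ⇑conjBDiffeo = conjB := rfl

/-- **The conjugate-and-unwind diffeomorphism** `g = E ∘ c` of the tube: the new embedding of the
tube is `jB ∘ g`. On the unit tube `g (x, w) = (x, w̄)`. [folklore] -/
def conjUnwind :
    ((𝕊 2) × 𝔼 2) ≃ₘ⟮(𝓡 2).prod 𝓘(ℝ, 𝔼 2), (𝓡 2).prod 𝓘(ℝ, 𝔼 2)⟯ ((𝕊 2) × 𝔼 2) :=
  conjBDiffeo.trans unwindEDiffeo

/-- `g = E ∘ c`. [folklore] -/
theorem conjUnwind_apply (b : (𝕊 2) × 𝔼 2) : conjUnwind b = unwindE (conjB b) := rfl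

/-- The fibre coordinate of `g b` is `w̄`. [folklore] -/
@[simp] theorem conjUnwind_snd (b : (𝕊 2) × 𝔼 2) : (conjUnwind b).2 = conjPlane b.2 := rfl

/-- **On the unit tube `g` is the conjugation of the fibre.** [folklore] -/
theorem conjUnwind_apply_of_norm_le_one {b : (𝕊 2) × 𝔼 2} (h : ‖b.2‖ ≤ 1) :
    conjUnwind b = (b.1, conjPlane b.2) := by
  rw [conjUnwind_apply, unwindE_of_norm_le_one (by simpa using h)]
  rfl

/-! ### I.5 The twirl map `H = τ E τ` of the punctured tube -/

/-- The **twirl map** `H (x, w) = (twirl_{s(w)} (w/‖w‖) x, w)` of the tube (junk: the identity on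
the zero section, where it is not continuous). Off the zero section `H = τ ∘ E ∘ τ`; `H = τ²` on
the punctured unit tube and `H = id` outside the tube of radius `2`. [folklore] -/
def unwindH (b : (𝕊 2) × 𝔼 2) : (𝕊 2) × 𝔼 2 :=
  if b.2 = 0 then b else (twirl (unwindAngle b.2) (unitVector₀ b.2) b.1, b.2)

/-- The inverse twirl map (same junk convention). [folklore] -/
def unwindHInv (b : (𝕊 2) × 𝔼 2) : (𝕊 2) × 𝔼 2 :=
  if b.2 = 0 then b else (untwirl (unwindAngle b.2) (unitVector₀ b.2) b.1, b.2)

/-- `H` preserves the fibre coordinate. [folklore] -/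
@[simp] theorem unwindH_snd (b : (𝕊 2) × 𝔼 2) : (unwindH b).2 = b.2 := by
  unfold unwindH
  split_ifs <;> rfl

/-- `H⁻¹` preserves the fibre coordinate. [folklore] -/
@[simp] theorem unwindHInv_snd (b : (𝕊 2) × 𝔼 2) : (unwindHInv b).2 = b.2 := by
  unfold unwindHInv
  split_ifs <;> rfl

/-- `H` off the zero section. [folklore] -/
theorem unwindH_of_ne_zero {b : (𝕊 2) × 𝔼 2} (hb : b.2 ≠ 0) :
    unwindH b = (twirl (unwindAngle b.2) (unitVector₀ b.2) b.1, b.2) := by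
  rw [unwindH, if_neg hb]

/-- `H⁻¹` off the zero section. [folklore] -/
theorem unwindHInv_of_ne_zero {b : (𝕊 2) × 𝔼 2} (hb : b.2 ≠ 0) :
    unwindHInv b = (untwirl (unwindAngle b.2) (unitVector₀ b.2) b.1, b.2) := by
  rw [unwindHInv, if_neg hb]

/-- `H⁻¹ ∘ H = id`. [folklore] -/
@[simp] theorem unwindHInv_unwindH (b : (𝕊 2) × 𝔼 2) : unwindHInv (unwindH b) = b := by
  obtain ⟨x, w⟩ := b
  by_cases hw : w = 0
  · subst hw
    simp [unwindH, unwindHInv]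
  · rw [unwindH_of_ne_zero (show (x, w).2 ≠ 0 from hw),
      unwindHInv_of_ne_zero (show (twirl (unwindAngle w) (unitVector₀ w) x, w).2 ≠ 0 from hw)]
    simp

/-- `H ∘ H⁻¹ = id`. [folklore] -/
@[simp] theorem unwindH_unwindHInv (b : (𝕊 2) × 𝔼 2) : unwindH (unwindHInv b) = b := by
  obtain ⟨x, w⟩ := b
  by_cases hw : w = 0
  · subst hw
    simp [unwindH, unwindHInv]
  · rw [unwindHInv_of_ne_zero (show (x, w).2 ≠ 0 from hw),
      unwindH_of_ne_zero (show (untwirl (unwindAngle w) (unitVector₀ w) x, w).2 ≠ 0 from hw)]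
    simp

/-- `H` is the identity outside the tube of radius `2`. [folklore] -/
theorem unwindH_of_two_le {b : (𝕊 2) × 𝔼 2} (h : 2 ≤ ‖b.2‖) : unwindH b = b := by
  obtain ⟨x, w⟩ := b
  have hw : w ≠ 0 := by
    rintro rfl
    rw [norm_zero] at h
    norm_num at h
  rw [unwindH_of_ne_zero (show (x, w).2 ≠ 0 from hw)]
  simp only [unwindAngle_of_two_le h, twirl_pi]

/-- `H⁻¹` is the identity outside the tube of radius `2`. [folklore] -/
theorem unwindHInv_of_two_le {b : (𝕊 2) × 𝔼 2} (h : 2 ≤ ‖b.2‖) : unwindHInv b = b := by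
  calc unwindHInv b = unwindHInv (unwindH b) := by rw [unwindH_of_two_le h]
    _ = b := unwindHInv_unwindH b

/-- `H` is smooth off the zero section. [folklore] -/
theorem contMDiffOn_unwindH :
    ContMDiffOn ((𝓡 2).prod 𝓘(ℝ, 𝔼 2)) ((𝓡 2).prod 𝓘(ℝ, 𝔼 2)) ∞ unwindH {b | b.2 ≠ 0} :=
  (contMDiffOn_twirl.prodMk contMDiff_snd.contMDiffOn).congr fun _ hb => unwindH_of_ne_zero hb

/-- `H⁻¹` is smooth off the zero section. [folklore] -/
theorem contMDiffOn_unwindHInv :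
    ContMDiffOn ((𝓡 2).prod 𝓘(ℝ, 𝔼 2)) ((𝓡 2).prod 𝓘(ℝ, 𝔼 2)) ∞ unwindHInv {b | b.2 ≠ 0} :=
  (contMDiffOn_untwirl.prodMk contMDiff_snd.contMDiffOn).congr fun _ hb => unwindHInv_of_ne_zero hb

/-- **The key identity `H (c (τ b)) = τ (g b)`** off the zero section: with `u = w/‖w‖`,
both sides are `(σ_s rot_ū σ_s x, w̄)`. This is the computation showing that the knot complement,
re-embedded through the push-forward of `H`, and the tube, re-embedded through `g`, are glued by
Gluck's map along the conjugate tubular neighbourhood `ν ∘ c`. [folklore] -/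
theorem unwindH_conjB_gluckMap {b : (𝕊 2) × 𝔼 2} (hb : b.2 ≠ 0) :
    unwindH (conjB (gluckMap b)) = gluckMap (conjUnwind b) := by
  obtain ⟨x, w⟩ := b
  change w ≠ 0 at hb
  have hw' : conjPlane w ≠ 0 := fun h => hb ((conjPlane_eq_zero_iff w).1 h)
  have hu : unitVector₀ (conjPlane w) = conjCircle (unitVector₀ w) := by
    rw [unitVector₀_of_ne_zero hw', unitVector₀_of_ne_zero hb, unitVector_conjPlane w hb]
    rfl
  rw [gluckMap_eq_of_ne_zero (show (x, w).2 ≠ 0 from hb)]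
  simp only [conjB]
  rw [unwindH_of_ne_zero (show (rotateSphereTwo (unitVector₀ w) x, conjPlane w).2 ≠ 0 from hw'),
    conjUnwind_apply]
  simp only [conjB, unwindE]
  rw [gluckMap_eq_of_ne_zero
    (show (spin (unwindAngle (conjPlane w)) (unitVector₀ (conjPlane w)) x, conjPlane w).2 ≠ 0
      from hw')]
  simp only [hu, unwindAngle_conjPlane, twirl_conjCircle_rotateSphereTwo]

/-! ### I.6 Pushing `H` forward to a diffeomorphism of the knot complement -/

section TubularNbhd

variable {K : TwoKnot} (ν : TwoKnot.TubularNbhd K)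

/-- The push-forward along `ν` of a fibre-preserving self-map of the tube maps the knot complement
to itself. [folklore] -/
theorem pushforward_mem_complement {Θ : (𝕊 2) × 𝔼 2 → (𝕊 2) × 𝔼 2}
    (hΘ : ∀ b, (Θ b).2 = b.2) {y : 𝕊 4} (hy : y ∈ K.complement) :
    ν.pushforward Θ y ∈ K.complement := by
  rw [SphereEmbedding.mem_complement_iff] at hy ⊢
  by_cases hyν : y ∈ range ν.toFun
  · obtain ⟨⟨x, w⟩, rfl⟩ := hyν
    have hw : w ≠ 0 := fun h => hy (ν.apply_mem_range_iff.2 h)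
    rw [ν.pushforward_apply]
    have hΘ' : Θ (x, w) = ((Θ (x, w)).1, w) := by
      conv_lhs => rw [← Prod.mk.eta (p := Θ (x, w)), hΘ (x, w)]
    rw [hΘ']
    exact ν.apply_mem_compl_range _ hw
  · rw [ν.pushforward_of_not_mem Θ hyν]
    exact hy

/-- **Smoothness of the push-forward at points of the knot complement**, for a map of the tube
which is smooth off the zero section only and is the identity outside a tube `S² × B̄_R`
(descent along the open immersion `ν`, `contMDiffAt_of_comp_isImmersionAt`, on the punctured
tube; the identity near the rest of the complement). [folklore] -/
theorem contMDiffAt_pushforward_of_mem_complement {Θ : (𝕊 2) × 𝔼 2 → (𝕊 2) × 𝔼 2}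
    (hΘs : ContMDiffOn ((𝓡 2).prod 𝓘(ℝ, 𝔼 2)) ((𝓡 2).prod 𝓘(ℝ, 𝔼 2)) ∞ Θ {b | b.2 ≠ 0})
    {R : ℝ} (hΘ : ∀ b : (𝕊 2) × 𝔼 2, R ≤ ‖b.2‖ → Θ b = b) {y : 𝕊 4} (hy : y ∈ K.complement) :
    ContMDiffAt (𝓡 4) (𝓡 4) ∞ (ν.pushforward Θ) y := by
  rw [SphereEmbedding.mem_complement_iff] at hy
  by_cases hyν : y ∈ range ν.toFun
  · obtain ⟨p, rfl⟩ := hyν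
    have hp : p.2 ≠ 0 := fun h => hy (by
      obtain ⟨x, w⟩ := p
      exact ν.apply_mem_range_iff.2 h)
    have hΘp : ContMDiffAt ((𝓡 2).prod 𝓘(ℝ, 𝔼 2)) ((𝓡 2).prod 𝓘(ℝ, 𝔼 2)) ∞ Θ p :=
      hΘs.contMDiffAt ((isOpen_ne.preimage continuous_snd).mem_nhds hp)
    exact contMDiffAt_of_comp_isImmersionAt (ν.isSmoothEmbedding.isImmersion.isImmersionAt p)
      ν.isOpenMap (ν.contMDiff.contMDiffAt.comp p hΘp) (fun p' => ν.pushforward_apply Θ p')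
  · have hC : IsClosed (ν.toFun '' (univ ×ˢ closedBall (0 : 𝔼 2) R)) :=
      ((isCompact_univ.prod (isCompact_closedBall _ _)).image ν.continuous).isClosed
    have hyC : y ∈ (ν.toFun '' (univ ×ˢ closedBall (0 : 𝔼 2) R))ᶜ := fun h =>
      hyν (image_subset_range _ _ h)
    refine contMDiffAt_id.congr_of_eventuallyEq ?_
    filter_upwards [hC.isOpen_compl.mem_nhds hyC] with z hz
    exact ν.pushforward_eq_self_of_not_mem_image hΘ hz

/-- **The unwinding diffeomorphism `ψ` of the knot complement**: the push-forward of the twirl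
map `H` along `ν` (identity outside `ν (S² × B̄₂)`; on the punctured tube `ν b ↦ ν (H b)`). It is
a diffeomorphism of `S⁴ ∖ K(S²)` only — `H = τ²` near the core does not extend over the knot.
[folklore] -/
def unwindPsi : K.complement ≃ₘ⟮𝓡 4, 𝓡 4⟯ K.complement where
  toFun a := ⟨ν.pushforward unwindH a, pushforward_mem_complement ν unwindH_snd a.2⟩
  invFun a := ⟨ν.pushforward unwindHInv a, pushforward_mem_complement ν unwindHInv_snd a.2⟩
  left_inv a := by
    apply Subtype.ext
    change ν.pushforward unwindHInv (ν.pushforward unwindH (a : 𝕊 4)) = a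
    rw [ν.pushforward_pushforward]
    convert ν.pushforward_id (a : 𝕊 4)
    funext p
    exact unwindHInv_unwindH p
  right_inv a := by
    apply Subtype.ext
    change ν.pushforward unwindH (ν.pushforward unwindHInv (a : 𝕊 4)) = a
    rw [ν.pushforward_pushforward]
    convert ν.pushforward_id (a : 𝕊 4)
    funext p
    exact unwindH_unwindHInv p
  contMDiff_toFun := by
    refine (ContMDiff.subtypeVal_comp_iff K.complement _).1 fun a => ?_
    exact contMDiffAt_subtype_iff.2
      (contMDiffAt_pushforward_of_mem_complement ν contMDiffOn_unwindH
        (fun b hb => unwindH_of_two_le hb) a.2)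
  contMDiff_invFun := by
    refine (ContMDiff.subtypeVal_comp_iff K.complement _).1 fun a => ?_
    exact contMDiffAt_subtype_iff.2
      (contMDiffAt_pushforward_of_mem_complement ν contMDiffOn_unwindHInv
        (fun b hb => unwindHInv_of_two_le hb) a.2)

/-- The underlying map of `ψ`. [folklore] -/
@[simp] theorem coe_unwindPsi_apply (a : K.complement) :
    ((unwindPsi ν a : K.complement) : 𝕊 4) = ν.pushforward unwindH a := rfl

/-! ### I.7 The conjugate tubular neighbourhood and the conjugate presentation -/

/-- **The conjugate tubular neighbourhood** `ν̄ = ν ∘ c`, `ν̄ (x, w) = ν (x, w̄)`: the same tube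
with the orientation of the fibres reversed. `Literature.Topology.FourManifolds.TwoKnot.TubularNbhd`
records no orientation, so `ν̄` is again a tubular neighbourhood of the same 2-knot `K`; its Gluck
relation glues by `τ⁻¹` where `ν` glues by `τ` (Gluck 1962, §8: the two twists give the same
manifold). [cite: GluckTAMS1962, §8] -/
def conjTube : TwoKnot.TubularNbhd K where
  toFun := ν.toFun ∘ conjBDiffeo
  isSmoothEmbedding := ν.isSmoothEmbedding.comp_diffeomorph conjBDiffeo
  apply_zero x := by
    simp only [comp_apply, coe_conjBDiffeo, conjB_zero, ν.apply_zero]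

/-- The conjugate tube as a function. [folklore] -/
@[simp] theorem conjTube_toFun_apply (b : (𝕊 2) × 𝔼 2) :
    (conjTube ν).toFun b = ν.toFun (conjB b) := rfl

variable {EX HX : Type*} [NormedAddCommGroup EX] [NormedSpace ℝ EX] [TopologicalSpace HX]
  {IX : ModelWithCorners ℝ EX HX} {X : Type*} [TopologicalSpace X] [ChartedSpace HX X]

/-- **The Gluck twist presented through the conjugate tubular neighbourhood (Gluck 1962, §8).**
Let `X` be an open gluing of the knot complement `S⁴ ∖ K(S²)` and the tube `S² × ℝ²` along
`gluckRel ν` by embeddings `jA`, `jB`. Then the SAME manifold `X` is an open gluing of the same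
pieces along `gluckRel ν̄`, `ν̄ = ν ∘ (id × conj)` the fibre-orientation-reversed tubular
neighbourhood, by the embeddings `jA ∘ ψ` and `jB ∘ g`: here `g = E ∘ c` is conjugation of the
fibre followed by the unwinding diffeomorphism `E` of the tube (`= id` on the unit tube, `= τ⁻²`
far out), and `ψ` is the push-forward to the knot complement of `H = τ E τ` (`= id` far out,
`= τ²` near the core). The relation holds because `H (c (τ b)) = τ (g b)`
(`unwindH_conjB_gluckMap`); the existence of `E` is the null-homotopy of `u ↦ rot_u²` in `SO(3)`
written as `rot_ū σ_s rot_u σ_s`, `s ∈ [0, π]` (`σ_π rot_u σ_π = rot_ū`). This is the formal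
content of the independence of the Gluck twist from the orientation of the normal bundle: the
twists by `τ` and by `τ⁻¹` yield the same manifold (Gluck, Trans. AMS 104 (1962), §8;
Gompf–Stipsicz, *4-Manifolds and Kirby Calculus* (1999), §6.2). The point of this explicit form
is the control it keeps on the tube embedding: on the unit tube the new embedding is
`jB ∘ (id × conj)`, an ORIENTATION-REVERSING reparametrisation of the old one fixing the core.
[cite: GluckTAMS1962, §8] -/
theorem isOpenGluing_gluckRel_conjTube_explicit [IsManifold IX ∞ X]
    {jA : K.complement → X} {jB : (𝕊 2) × 𝔼 2 → X}
    (hA : Manifold.IsSmoothEmbedding (𝓡 4) IX ∞ jA) (hAo : IsOpen (range jA))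
    (hB : Manifold.IsSmoothEmbedding ((𝓡 2).prod 𝓘(ℝ, 𝔼 2)) IX ∞ jB) (hBo : IsOpen (range jB))
    (hU : range jA ∪ range jB = univ) (hR : ∀ a b, jA a = jB b ↔ gluckRel ν a b) :
    Manifold.IsSmoothEmbedding (𝓡 4) IX ∞ (jA ∘ unwindPsi ν) ∧
      IsOpen (range (jA ∘ unwindPsi ν)) ∧
      Manifold.IsSmoothEmbedding ((𝓡 2).prod 𝓘(ℝ, 𝔼 2)) IX ∞ (jB ∘ conjUnwind) ∧
      IsOpen (range (jB ∘ conjUnwind)) ∧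
      range (jA ∘ unwindPsi ν) ∪ range (jB ∘ conjUnwind) = univ ∧
      ∀ a b, (jA ∘ unwindPsi ν) a = (jB ∘ conjUnwind) b ↔ gluckRel (conjTube ν) a b := by
  have hψs : Surjective (unwindPsi ν : K.complement → K.complement) := (unwindPsi ν).surjective
  have hgs : Surjective (conjUnwind : (𝕊 2) × 𝔼 2 → (𝕊 2) × 𝔼 2) := conjUnwind.surjective
  refine ⟨hA.comp_diffeomorph (unwindPsi ν), by rw [hψs.range_comp]; exact hAo,
    hB.comp_diffeomorph conjUnwind, by rw [hgs.range_comp]; exact hBo,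
    by rw [hψs.range_comp, hgs.range_comp]; exact hU, fun a b => ?_⟩
  rw [comp_apply, comp_apply, hR]
  simp only [gluckRel, conjUnwind_snd, ne_eq, conjPlane_eq_zero_iff, coe_unwindPsi_apply,
    conjTube_toFun_apply]
  constructor
  · rintro ⟨hb, h⟩
    refine ⟨hb, ?_⟩
    by_cases haν : (a : 𝕊 4) ∈ range ν.toFun
    · obtain ⟨q, hq⟩ := haν
      rw [← hq, ν.pushforward_apply, ← unwindH_conjB_gluckMap hb] at h
      have h' : q = conjB (gluckMap b) := by
        have h'' := congrArg unwindHInv (ν.injective h)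
        rwa [unwindHInv_unwindH, unwindHInv_unwindH] at h''
      rw [← hq, h']
    · exfalso
      rw [ν.pushforward_of_not_mem _ haν] at h
      exact haν ⟨_, h.symm⟩
  · rintro ⟨hb, h⟩
    refine ⟨hb, ?_⟩
    rw [h, ν.pushforward_apply, unwindH_conjB_gluckMap hb]

/-- **The Gluck twist does not depend on the orientation of the tubular neighbourhood**
(relational form): an open gluing along `gluckRel ν` is an open gluing along `gluckRel ν̄`.
[cite: GluckTAMS1962, §8] -/
theorem isOpenGluing_gluckRel_conjTube [IsManifold IX ∞ X]
    (h : IsOpenGluing (𝓡 4) ((𝓡 2).prod 𝓘(ℝ, 𝔼 2)) IX (A := K.complement) (B := (𝕊 2) × 𝔼 2)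
      (P := X) (gluckRel ν)) :
    IsOpenGluing (𝓡 4) ((𝓡 2).prod 𝓘(ℝ, 𝔼 2)) IX (A := K.complement) (B := (𝕊 2) × 𝔼 2)
      (P := X) (gluckRel (conjTube ν)) := by
  obtain ⟨jA, jB, hA, hAo, hB, hBo, hU, hR⟩ := h
  obtain ⟨hA', hAo', hB', hBo', hU', hR'⟩ :=
    isOpenGluing_gluckRel_conjTube_explicit ν hA hAo hB hBo hU hR
  exact ⟨_, _, hA', hAo', hB', hBo', hU', hR'⟩

end TubularNbhd

/-! ### I.8 Gluck twists are connected -/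

section Connected

variable {K : TwoKnot} {ν : TwoKnot.TubularNbhd K}
  {EX HX : Type*} [NormedAddCommGroup EX] [NormedSpace ℝ EX] [TopologicalSpace HX]
  {IX : ModelWithCorners ℝ EX HX} {X : Type*} [TopologicalSpace X] [ChartedSpace HX X]

/-- **A Gluck twist is connected**: it is the union of the images of the knot complement (path
connected, `TwoKnot.TubularNbhd.pathConnectedSpace_complement`) and of the tube `S² × ℝ²`, which
meet. (Gluck 1962, §17 proves much more: `Σ_K` is a homotopy 4-sphere.) [cite: GluckTAMS1962, §17] -/
theorem connectedSpace_of_isOpenGluing_gluckRel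
    (h : IsOpenGluing (𝓡 4) ((𝓡 2).prod 𝓘(ℝ, 𝔼 2)) IX (A := K.complement) (B := (𝕊 2) × 𝔼 2)
      (P := X) (gluckRel ν)) : ConnectedSpace X := by
  obtain ⟨jA, jB, hA, -, hB, -, hU, hR⟩ := h
  haveI := TwoKnot.TubularNbhd.pathConnectedSpace_complement ν
  haveI : PreconnectedSpace (𝕊 2) := preconnectedSpace_sphereTwo
  haveI : ConnectedSpace (𝕊 2) := ⟨⟨⟨EuclideanSpace.single 0 1, by simp⟩⟩⟩
  have h1 : IsConnected (range jA) := isConnected_range hA.contMDiff.continuous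
  have h2 : IsConnected (range jB) := isConnected_range hB.contMDiff.continuous
  set x₀ : 𝕊 2 := ⟨EuclideanSpace.single 0 1, by simp⟩
  set w₀ : 𝔼 2 := EuclideanSpace.single 0 1
  have hw₀ : w₀ ≠ 0 := fun h => by
    have := congrArg (fun v : 𝔼 2 => v 0) h
    simp [w₀] at this
  have hmem : ν.toFun (gluckMap (x₀, w₀)) ∈ K.complement := by
    rw [gluckMap_apply_of_ne_zero x₀ hw₀]
    exact ν.apply_mem_compl_range _ hw₀
  have h12 : IsConnected (range jA ∪ range jB) :=
    IsConnected.union ⟨jB (x₀, w₀), ⟨⟨_, hmem⟩, (hR _ _).2 (gluckRel_mk_gluckMap ν x₀ hw₀ hmem)⟩,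
      mem_range_self _⟩ h1 h2
  rw [hU] at h12
  exact connectedSpace_iff_univ.2 h12

/-- A Gluck twist of `S⁴` is connected. [cite: GluckTAMS1962, §17] -/
theorem connectedSpace_of_isGluckTwist (h : IsGluckTwist IX X K) : ConnectedSpace X := by
  obtain ⟨ν, hν⟩ := h
  exact connectedSpace_of_isOpenGluing_gluckRel hν

end Connected

/-! ## Part II. Connected sums: explicit discs, transport, and the disc-theorem dichotomy -/

/-! ### II.1 The dissolution manifold is a connected sum with EXPLICIT discs -/

section ExplicitDiscs

open Literature.Topology.FourManifolds.ToricBlowup Literature.Topology.FourManifolds.SphereCoord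
open Literature.Topology.FourManifolds.TwoKnot.TubularNbhd
open Literature.Topology.FourManifolds.TwoKnot.TubularNbhd.DissolveSide

variable {K : TwoKnot} {ν : TwoKnot.TubularNbhd K}
  {Y : Type} [TopologicalSpace Y] [T2Space Y] [ChartedSpace (𝔼 4) Y] [IsManifold (𝓡 4) ∞ Y]

/-- **The glued manifold `M = ν.Dissolve` is the open gluing of `Y ∖ {jB p}` and `ℂℙ² ∖ {q}` along
Kervaire–Milnor's relation for the very discs `c₁ = jB ∘ discB`, `c₂ = (affineChart 2)⁻¹`.**
This is the tree's assembly lemma `DissolveSide.isConnectedSum` (`GluckDissolveAssembly.lean`)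
with the existential over the discs opened up: the same neck presentation, fed to
`isOpenGluing_connectedSumRel_of_neck` instead of `isConnectedSum_of_neck`
(Kosinski, *Differential Manifolds* (1993), VI §1, Prop. 1.3). The explicit discs are what the
disc-theorem comparison with an arbitrary connected sum needs.
[cite: Kosinski1993, Ch. VI §1 (p. 90; Prop. 1.3)] -/
theorem dissolveSide_isOpenGluing_connectedSumRel (S : DissolveSide ν Y) :
    IsOpenGluing (𝓡 4) (𝓡 4) (𝓡 4) (A := puncture S.cOne) (B := puncture cTwo) (P := ν.Dissolve)
      (connectedSumRel S.cOne cTwo) := by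
  haveI := Fact.mk (@finrank_euclideanSpace_fin ℝ _ 4)
  refine isOpenGluing_connectedSumRel_of_neck (n := 3) S.cOne cTwo (ψ := S.j ∘ neckV)
    (e₁ := S.eOne) (e₂ := S.eTwoM) S.isSmoothEmbedding_neck ?_ S.isSmoothEmbedding_eOne
    S.isOpen_range_eOne S.isSmoothEmbedding_eTwoM S.isOpen_range_eTwoM S.disjoint_range
    S.neck_zero_not_mem_range_eOne S.neck_zero_not_mem_range_eTwoM
    (fun m h1 h2 => S.exists_neck_zero_eq h1 h2) (fun θ t ht => ?_) (fun θ t ht => ?_)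
  · rw [range_comp]
    exact (_root_.Topology.IsOpenEmbedding.mk S.hj.isEmbedding S.hjo).isOpenMap _ isOpen_range_neckV
  · have hne : discB (t • (θ : 𝔼 4)) ≠ ToricBlowup.basePt :=
      discB_ne_basePt (smul_ne_zero ht.ne' (ne_zero_of_mem_unit_sphere θ))
    exact ⟨⟨S.jB (discB (t • (θ : 𝔼 4))), S.jB_mem_puncture hne⟩, rfl, by
      rw [S.eOne_jB hne, toModel_ΘB_discB_smul θ ht]; rfl⟩
  · have hmem : cTwo (t • (θ : 𝔼 4)) ∈ puncture cTwo := by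
      rw [mem_puncture]
      intro h
      have := isSmoothEmbedding_cTwo.isEmbedding.injective h
      exact smul_ne_zero ht.ne' (ne_zero_of_mem_unit_sphere θ) this
    exact ⟨⟨cTwo (t • (θ : 𝔼 4)), hmem⟩, rfl, by
      change S.j (eTwo (cTwo (t • (θ : 𝔼 4)))) = S.j (neckV (θ, -t))
      rw [cTwo, eTwo_affine₂_smul' θ ht]⟩

/-- **The reflection of `ℝ⁴` matching the conjugation of the fibre under the polar disc.** There
is a linear isometric involution `r` of `ℝ⁴` of negative determinant (the reflection
`y₃ ↦ -y₃`, Mathlib's `Submodule.reflection` in the hyperplane orthogonal to `e₃`) with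
`discB (r y) = c (discB y)` for the polar disc `discB` of the toric model
(`discB y = (ξ⁻¹ (y₀ + i y₂), (y₁, y₃))`) and the fibre conjugation `c (x, w) = (x, w̄)`.
[folklore] -/
theorem exists_reflection_discB_eq_conjB :
    ∃ r : 𝔼 4 ≃ₗᵢ[ℝ] 𝔼 4,
      LinearMap.det (r.toLinearEquiv : 𝔼 4 →ₗ[ℝ] 𝔼 4) < 0 ∧ (∀ y, r (r y) = y) ∧
        ∀ y, discB (r y) = conjB (discB y) := by
  set e₃ : 𝔼 4 := EuclideanSpace.single 3 1 with he₃_def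
  have he₃ : e₃ ≠ 0 := fun h => by
    have := congrArg (fun v : 𝔼 4 => v 3) h
    simp [he₃_def] at this
  have hr : ∀ y : 𝔼 4, (ℝ ∙ e₃)ᗮ.reflection y = !₂[y 0, y 1, y 2, -(y 3)] := fun y => by
    rw [reflection_orthogonal_singleton_apply]
    ext i
    fin_cases i
    · simp [he₃_def, EuclideanSpace.inner_single_left]
    · simp [he₃_def, EuclideanSpace.inner_single_left]
    · simp [he₃_def, EuclideanSpace.inner_single_left]
    · simp [he₃_def, EuclideanSpace.inner_single_left]; ring
  refine ⟨(ℝ ∙ e₃)ᗮ.reflection, ?_, fun y => Submodule.reflection_reflection _ y, fun y => ?_⟩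
  · have h := (ℝ ∙ e₃)ᗮ.det_reflection
    have hKo : (ℝ ∙ e₃)ᗮᗮ = ℝ ∙ e₃ := Submodule.orthogonal_orthogonal _
    rw [hKo, finrank_span_singleton he₃, pow_one] at h
    have h' : LinearMap.det ((ℝ ∙ e₃)ᗮ.reflection.toLinearEquiv : 𝔼 4 →ₗ[ℝ] 𝔼 4) = -1 := h
    rw [h']
    norm_num
  · rw [hr y]
    refine Prod.ext ?_ ?_
    · change invXi (toC2 !₂[y 0, y 1, y 2, -(y 3)]).1 = invXi (toC2 y).1
      congr 1
    · change planeR (toC2 !₂[y 0, y 1, y 2, -(y 3)]).2 = conjPlane (planeR (toC2 y).2)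
      ext i
      fin_cases i <;> simp [toC2, planeR]

end ExplicitDiscs

/-! ### II.2 Transport of a connected-sum gluing along diffeomorphisms of the summands -/

section Transport

variable {E : Type*} [NormedAddCommGroup E] [NormedSpace ℝ E]
  {EN : Type*} [NormedAddCommGroup EN] [NormedSpace ℝ EN]
  {HM HN HP : Type*} [TopologicalSpace HM] [TopologicalSpace HN] [TopologicalSpace HP]
  {IM : ModelWithCorners ℝ E HM} {IN : ModelWithCorners ℝ EN HN} {IP : ModelWithCorners ℝ E HP}
  {M N P : Type*} [TopologicalSpace M] [T2Space M] [ChartedSpace HM M] [IsManifold IM ∞ M]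
  [TopologicalSpace N] [T2Space N] [ChartedSpace HN N] [IsManifold IN ∞ N]
  [TopologicalSpace P] [ChartedSpace HP P]

/-- **Transport of a connected-sum gluing.** If `P` is an open gluing of `M ∖ {i₁ 0}` and
`N ∖ {i₂ 0}` along Kervaire–Milnor's relation for the discs `(i₁, i₂)`, and diffeomorphisms
`F ∈ Diff(M)`, `G ∈ Diff(N)` carry these discs to `(i₁' ∘ ρ, i₂' ∘ ρ)` on the closed unit ball
(`ρ` a linear isometry), then `P` is also an open gluing of `M ∖ {i₁' 0}`, `N ∖ {i₂' 0}` along the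
relation for `(i₁', i₂')` — compose the gluing embeddings with the restrictions of `F⁻¹`, `G⁻¹`
(Kervaire–Milnor, *Groups of homotopy spheres I* (1963), §2, proof of Lemma 2.1; this is the
re-reading step inside the tree's
`nonempty_diffeomorph_of_isConnectedSum_of_discs_equivalent`, isolated).
[cite: KervaireMilnorAnnals1963, §2, Lemma 2.1 (p. 505)] -/
theorem isOpenGluing_connectedSumRel_transport {i₁ i₁' : E → M} {i₂ i₂' : E → N}
    (F : M ≃ₘ⟮IM, IM⟯ M) (G : N ≃ₘ⟮IN, IN⟯ N) (ρ : E ≃ₗᵢ[ℝ] E)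
    (hF : ∀ y : E, ‖y‖ ≤ 1 → F (i₁ y) = i₁' (ρ y))
    (hG : ∀ y : E, ‖y‖ ≤ 1 → G (i₂ y) = i₂' (ρ y))
    (h : IsOpenGluing IM IN IP (A := puncture i₁) (B := puncture i₂) (P := P)
      (connectedSumRel i₁ i₂)) :
    IsOpenGluing IM IN IP (A := puncture i₁') (B := puncture i₂') (P := P)
      (connectedSumRel i₁' i₂') := by
  obtain ⟨jA, jB, hA, hAo, hB, hBo, hU, hR⟩ := h
  have hF0 : F (i₁ 0) = i₁' 0 := by have := hF 0 (by simp); simpa using this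
  have hG0 : G (i₂ 0) = i₂' 0 := by have := hG 0 (by simp); simpa using this
  obtain ⟨ψA, hψA⟩ := exists_diffeomorph_opens F.symm (puncture i₁') (puncture i₁) (fun x => by
    simp only [mem_puncture]
    rw [← hF0]
    exact ⟨fun h1 h2 => h1 (by rw [h2, F.symm_apply_apply]), fun h1 h2 => h1 (by
      rw [← F.apply_symm_apply x, h2])⟩)
  obtain ⟨ψB, hψB⟩ := exists_diffeomorph_opens G.symm (puncture i₂') (puncture i₂) (fun x => by
    simp only [mem_puncture]
    rw [← hG0]
    exact ⟨fun h1 h2 => h1 (by rw [h2, G.symm_apply_apply]), fun h1 h2 => h1 (by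
      rw [← G.apply_symm_apply x, h2])⟩)
  have hrA : range (jA ∘ ψA) = range jA := ψA.surjective.range_comp jA
  have hrB : range (jB ∘ ψB) = range jB := ψB.surjective.range_comp jB
  refine ⟨jA ∘ ψA, jB ∘ ψB, hA.comp_diffeomorph ψA, ?_, hB.comp_diffeomorph ψB, ?_, ?_,
    fun a b => ?_⟩
  · rw [hrA]; exact hAo
  · rw [hrB]; exact hBo
  · rw [hrA, hrB, hU]
  · rw [comp_apply, comp_apply, hR]
    exact connectedSumRel_iff_of_apply_disc_eq F G ρ hF hG (ψA a) (ψB b) a b (hψA a) (hψB b)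

/-- **The disc-theorem dichotomy for a connected sum.** Let `M`, `L` be connected, both modelled
on the disc space `E`, and let `c₁ : E → M`, `c₂ : E → L` be reference discs; fix a linear isometric involution `r` of `E` with
`det r < 0`. If `P` is an open gluing along Kervaire–Milnor's relation for SOME discs `(i₁, i₂)`,
then `P` is an open gluing along the relation for `(c₁, c₂)` OR for `(c₁ ∘ r, c₂)`: by the
unoriented disc theorem (`exists_diffeomorph_apply_disc_eq_or_reflect_of_model`; Palais 1960,
Thm. B; Kosinski 1993, III.(3.6)) `i₁` is carried onto `c₁` or `c₁ ∘ r` by a diffeomorphism of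
`M`, `i₂` onto `c₂` or `c₂ ∘ r` by one of `L`, and a common reflection is absorbed by the
reparametrisation `u ↦ r u` of the relation (`isOpenGluing_connectedSumRel_transport` with
`ρ = r`). This is the orientation-free content of "the connected sum is well defined up to the
two choices `M # N`, `M # (-N)`" (Kervaire–Milnor 1963, §2).
[cite: KervaireMilnorAnnals1963, §2, Lemma 2.1 (p. 505)] [cite: Palais1960, Thm. B] -/
theorem isOpenGluing_connectedSumRel_or_reflect [FiniteDimensional ℝ E] [ConnectedSpace M]
    {HL : Type*} [TopologicalSpace HL] {IL : ModelWithCorners ℝ E HL}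
    {L : Type*} [TopologicalSpace L] [T2Space L] [ChartedSpace HL L] [IsManifold IL ∞ L]
    [ConnectedSpace L] (hE : finrank ℝ E ≠ 0) (r : E ≃ₗᵢ[ℝ] E)
    (hr : LinearMap.det (r.toLinearEquiv : E →ₗ[ℝ] E) < 0) (hrr : ∀ y, r (r y) = y)
    {i₁ c₁ : E → M} {i₂ c₂ : E → L}
    (hi₁ : Manifold.IsSmoothEmbedding 𝓘(ℝ, E) IM ∞ i₁)
    (hc₁ : Manifold.IsSmoothEmbedding 𝓘(ℝ, E) IM ∞ c₁)
    (hi₂ : Manifold.IsSmoothEmbedding 𝓘(ℝ, E) IL ∞ i₂)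
    (hc₂ : Manifold.IsSmoothEmbedding 𝓘(ℝ, E) IL ∞ c₂)
    (h : IsOpenGluing IM IL IP (A := puncture i₁) (B := puncture i₂) (P := P)
      (connectedSumRel i₁ i₂)) :
    IsOpenGluing IM IL IP (A := puncture c₁) (B := puncture c₂) (P := P)
        (connectedSumRel c₁ c₂) ∨
      IsOpenGluing IM IL IP (A := puncture (c₁ ∘ r)) (B := puncture c₂) (P := P)
        (connectedSumRel (c₁ ∘ r) c₂) := by
  have hr' : LinearMap.det ((r.toContinuousLinearEquiv).toLinearEquiv : E →ₗ[ℝ] E) < 0 := hr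
  have nr : ∀ y : E, ‖r y‖ = ‖y‖ := r.norm_map
  obtain ⟨F, hF⟩ := exists_diffeomorph_apply_disc_eq_or_reflect_of_model hE hi₁ hc₁
    r.toContinuousLinearEquiv hr'
  obtain ⟨G, hG⟩ := exists_diffeomorph_apply_disc_eq_or_reflect_of_model hE hi₂ hc₂
    r.toContinuousLinearEquiv hr'
  simp only [LinearIsometryEquiv.coe_toContinuousLinearEquiv] at hF hG
  rcases hF with hF | hF <;> rcases hG with hG | hG
  · left
    exact isOpenGluing_connectedSumRel_transport F G (LinearIsometryEquiv.refl ℝ E)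
      (fun y hy => by simpa using hF y hy) (fun y hy => by simpa using hG y hy) h
  · right
    refine isOpenGluing_connectedSumRel_transport F G r (fun y hy => ?_) (fun y hy => ?_) h
    · rw [comp_apply, hrr, hF y hy]
    · have := hG (r y) (by rw [nr]; exact hy)
      rwa [hrr] at this
  · right
    refine isOpenGluing_connectedSumRel_transport F G (LinearIsometryEquiv.refl ℝ E)
      (fun y hy => ?_) (fun y hy => by simpa using hG y hy) h
    have := hF (r y) (by rw [nr]; exact hy)
    rw [hrr] at this
    simpa using this
  · left
    refine isOpenGluing_connectedSumRel_transport F G r (fun y hy => ?_) (fun y hy => ?_) h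
    · have := hF (r y) (by rw [nr]; exact hy)
      rwa [hrr] at this
    · have := hG (r y) (by rw [nr]; exact hy)
      rwa [hrr] at this

end Transport

/-! ## Part III. The dissolution fact -/

section Main

open Literature.Topology.FourManifolds.ToricBlowup Literature.Topology.FourManifolds.SphereCoord
open Literature.Topology.FourManifolds.TwoKnot.TubularNbhd
open Literature.Topology.FourManifolds.TwoKnot.TubularNbhd.DissolveSide

/-- **Gluck twists dissolve after one `ℂℙ²` summand — discharge of the named fact
`gluckTwist_connectedSum_complexProjectivePlane`.** For every 2-knot `K`, every Gluck twist `X`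
of `S⁴` along `K` and EVERY connected sum `P` of `X` with `ℂℙ²` (the tree's orientation-free
`IsConnectedSum`, i.e. both `X # ℂℙ²` and `X # ℂℙ²bar`), `P ≅ ℂℙ²`. Proof. Write `X` as the open
gluing of `S⁴ ∖ K(S²)` and `S² × ℝ²` along `gluckRel ν` by `(jA, jB)`. The tree's toric blow-up
model gives a closed smooth `M = ν.Dissolve` which is an open gluing along Kervaire–Milnor's
relation for the discs `(jB ∘ discB, (affineChart 2)⁻¹)` and a connected sum `S⁴ # ℂℙ²`, hence
`M ≅ ℂℙ²` (`X # Sⁿ ≅ X` for arbitrary discs, `nonempty_diffeomorph_of_isConnectedSum_sphere'`).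
The same applied to the conjugate tube `ν̄ = ν ∘ (id × conj)` and the conjugate presentation
`(jA ∘ ψ, jB ∘ g)` of Part I gives `M̄ = ν̄.Dissolve ≅ ℂℙ²`, an open gluing for the discs
`(jB ∘ g ∘ discB, (affineChart 2)⁻¹)` with `jB ∘ g ∘ discB = jB ∘ discB ∘ r` on the unit ball,
`r` the reflection `y₃ ↦ -y₃` of `ℝ⁴`. By the disc-theorem dichotomy
(`isOpenGluing_connectedSumRel_or_reflect`, `X` and `ℂℙ²` connected) the given `P` is an open
gluing along the relation for `(jB ∘ discB, (affineChart 2)⁻¹)` or for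
`(jB ∘ discB ∘ r, (affineChart 2)⁻¹)`, hence diffeomorphic to `M` or to `M̄` by the uniqueness of
open gluings (`IsOpenGluing.exists_diffeomorph_comp_eq`). Sources for the statement:
Kasprowski–Powell–Ray 2023, Lemma 3.1 (smooth case, after Gompf–Stipsicz 1999, Ex. 5.2.7(b));
Akbulut–Yasui 2013, Cor. 1.3; for Gluck twists of `S⁴` both `X # ℂℙ² ≅ ℂℙ²` and
`X # ℂℙ²bar ≅ ℂℙ²bar`, Manolescu–Marengon–Sarkar–Willis 2023, proof of Cor. 6.15; the
orientation symmetry of the twist, Gluck 1962, §8.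
[cite: KasprowskiPowellRay2023, Lemma 3.1] [cite: AkbulutYasui2013, Cor. 1.3]
[cite: GompfStipsicz1999, Exercise 5.2.7(b)] [cite: GluckTAMS1962, §8] -/
theorem gluckTwist_connectedSum_complexProjectivePlane_holds :
    gluckTwist_connectedSum_complexProjectivePlane := by
  intro K X _ _ _ _ _ hX P _ _ _ _ _ hP
  obtain ⟨ν, hν⟩ := hX
  haveI : ConnectedSpace X := connectedSpace_of_isOpenGluing_gluckRel hν
  obtain ⟨jA, jB, hA, hAo, hB, hBo, hU, hR⟩ := hν
  haveI : Fact (finrank ℝ (𝔼 4) = 3 + 1) := ⟨by simp⟩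
  -- the two dissolutions `M = ν.Dissolve`, `M̄ = ν̄.Dissolve`, with explicit discs
  set S : DissolveSide ν X := ν.twistedSide jA jB hA hAo hB hBo hU hR with hS_def
  obtain ⟨hA', hAo', hB', hBo', hU', hR'⟩ :=
    isOpenGluing_gluckRel_conjTube_explicit ν hA hAo hB hBo hU hR
  set S' : DissolveSide (conjTube ν) X :=
    (conjTube ν).twistedSide (jA ∘ unwindPsi ν) (jB ∘ conjUnwind) hA' hAo' hB' hBo' hU' hR'
    with hS'_def
  have hM := dissolveSide_isOpenGluing_connectedSumRel S
  have hM' := dissolveSide_isOpenGluing_connectedSumRel S'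
  -- the discs of `M̄` are the reflected discs of `M`
  obtain ⟨r, hrdet, hrr, hrdisc⟩ := exists_reflection_discB_eq_conjB
  have hcOne : ∀ y : 𝔼 4, ‖y‖ ≤ 1 → S'.cOne y = (S.cOne ∘ r) y := fun y hy => by
    change jB (conjUnwind (discB y)) = jB (discB (r y))
    rw [hrdisc, conjUnwind_apply_of_norm_le_one ((norm_discB_snd_le y).trans hy)]
    rfl
  have hM'' : IsOpenGluing (𝓡 4) (𝓡 4) (𝓡 4) (A := puncture (S.cOne ∘ r)) (B := puncture cTwo)
      (P := (conjTube ν).Dissolve) (connectedSumRel (S.cOne ∘ r) cTwo) :=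
    isOpenGluing_connectedSumRel_transport (Diffeomorph.refl (𝓡 4) X ∞)
      (Diffeomorph.refl (𝓡 4) ComplexProjectivePlane ∞) (LinearIsometryEquiv.refl ℝ (𝔼 4))
      (fun y hy => by simpa using hcOne y hy) (fun y _ => rfl) hM'
  -- both dissolutions are `ℂℙ²`
  obtain ⟨eM⟩ := nonempty_diffeomorph_of_isConnectedSum_sphere' ν.isConnectedSum_sphere_dissolve.symm
  obtain ⟨eM'⟩ :=
    nonempty_diffeomorph_of_isConnectedSum_sphere' (conjTube ν).isConnectedSum_sphere_dissolve.symm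
  -- the given connected sum is one of the two
  obtain ⟨i₁, i₂, hi₁, hi₂, hG⟩ := hP
  have hE : finrank ℝ (𝔼 4) ≠ 0 := by simp
  rcases isOpenGluing_connectedSumRel_or_reflect hE r hrdet hrr hi₁ S.isSmoothEmbedding_cOne hi₂
      isSmoothEmbedding_cTwo hG with h | h
  · obtain ⟨pA, pB, h1, h2, h3, h4, h5, h6⟩ := h
    obtain ⟨mA, mB, k1, k2, k3, k4, k5, k6⟩ := hM
    obtain ⟨Φ, -, -⟩ := IsOpenGluing.exists_diffeomorph_comp_eq h1 h2 h3 h4 h5 h6 k1 k2 k3 k4 k5 k6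
    exact ⟨Φ.trans eM⟩
  · obtain ⟨pA, pB, h1, h2, h3, h4, h5, h6⟩ := h
    obtain ⟨mA, mB, k1, k2, k3, k4, k5, k6⟩ := hM''
    obtain ⟨Φ, -, -⟩ := IsOpenGluing.exists_diffeomorph_comp_eq h1 h2 h3 h4 h5 h6 k1 k2 k3 k4 k5 k6
    exact ⟨Φ.trans eM'⟩

end Main

end Literature.Barriers.SmoothPoincare4
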